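import Literature.Computability.QuantumComplexity.SketchedOversamplingAccess
import Literature.Analysis.Matrix.HoffmanWielandt
import Literature.Analysis.Matrix.ABvsBAEigenvalues
import Mathlib.Analysis.InnerProductSpace.PiL2
import HarnessLib

/-!
# Approximating singular values by sketching `A` down to `SAT` (CGLLTW 2022, §3.2 / §5.2)

Chia, Gilyén, Li, Lin, Tang, Wang, J. ACM 69(5):33 (2022) = arXiv:1910.06151, **§3.2 Lemma
"Approximating singular values"** (held arXiv text p. 19 L25–36) and its proof in §5.2 (p. 37 L1–23):

> **Lemma.** Given `SQ_φ(A) ∈ ℂ^{m×n}` and `ε ∈ (0,1]`, we can form importance sampling sketches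
> `S ∈ ℝ^{r×m}` and `T† ∈ ℝ^{c×n}` in `O((r+c) s_φ(A))` time satisfying the following property. Take
> `r = Ω̃(φ²/ε² · log(1/δ))` and `c = Ω̃(φ²/ε² · log(1/δ))`. Then, if `σ_i` and `σ̂_i` are the singular
> values of `A` and `SAT`, respectively (where `σ̂_i = 0` for `i > min(r,c)`), with probability
> `≥ 1−δ`, `√(Σ_{i=1}^{min(m,n)} (σ̂_i² − σ_i²)²) ≤ ε‖A‖_F²`.
>
> *Proof.* […] Using Lemma "Approximating matrix multiplication" for the sketch `S`, we know that
> `Pr[‖A†S†SA − A†A‖_F ≤ ε‖A‖_F²] ≥ 1−δ`; by (lem:sq-sketching), `T†` is an `≤ 2φ`-oversampled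
> importance sampling sketch of `(SA)†`, so by [the same lemma] for `T†`,
> `Pr[‖SATT†A†S† − SAA†S†‖_F ≤ (ε/2)‖SA‖_F²] ≥ 1−δ`, and from (lem:sa-frob-norm),
> `Pr[‖SA‖_F² ≤ 2‖A‖_F²] ≥ 1−δ`. By rescaling `δ` and union bounding, we can have all events happen
> with probability `≥ 1−δ`. Then, from Lemma 5.2 (Hoffman–Wielandt),
> `√Σ(σ_i(SA)² − σ_i(A)²)² ≤ ε‖A‖_F²`, `√Σ(σ_i(SAT)² − σ_i(SA)²)² ≤ ε‖A‖_F²`. The result follows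
> from the triangle inequality. □

This file assembles the printed proof end to end (real entries, Frobenius form, explicit constants)
from the tree's pieces: the key lemma `approx_matrix_product'` (twice), Lemma 2.14
(`SketchedOversamplingAccess`: the witness `SQ_{φ_ω}((S_ωA)ᵀ)` with `φ_ω ≤ 2φ` on the event
`‖S_ωA‖_F² ≥ ½‖A‖_F²`, whose complement has mass `≤ δ₃` for `s ≥ 2φ² ln(1/δ₃)`), Hoffman–Wielandt
(`hoffman_wielandt_real`), and the zero-padding convention "`σ̂_i = 0` for `i > min(r,c)`" made
precise by `ABvsBAEigenvalues` (`(SA)ᵀ(SA)` and `(SA)(SA)ᵀ` have the same padded sorted spectrum):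

* `sqSingularValues M : ℕ → ℝ` — the squared singular values `σ_1(M)² ≥ σ_2(M)² ≥ …` of a real
  matrix (sorted eigenvalues of `MᵀM`), padded by zeros; `sqSingularValues_transpose`.
* `l2dist N f g = √(Σ_{k<N} (f k − g k)²)` and its triangle inequality.
* `sqSingularValues_dist_le_frob` (Hoffman–Wielandt, padded): for `B, A` with the same number of
  columns, `l2dist N (σ²(B)) (σ²(A)) ≤ ‖BᵀB − AᵀA‖_F`.
* `sqSingularValues_sketch_dist_le` (deterministic core of the proof): for any row sample `ω` and
  column sample `τ`, with `R = S_ωA`, `C = R T_τ`,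
  `l2dist N (σ²(C)) (σ²(A)) ≤ ‖(T'Rᵀ)ᵀ(T'Rᵀ) − RRᵀ‖_F + ‖RᵀR − AᵀA‖_F` (`T' = T_τᵀ`).
* `approximating_singular_values` — **the Lemma**: for `SQ_φ(A)`, `A ≠ 0`, `s, c ≥ 1` and
  `δ₁, δ₂, δ₃ > 0` with `s ≥ 2φ² ln(1/δ₃)`, the two-stage mass (rows `ω ∼ 𝒟_ã^s`, then columns
  `τ ∼ (𝒟 of the row norms of (S_ωÃ)ᵀ)^c`, the `SQ((SA)†)` sampler of Lemma 2.14) of the outcomes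
  with `l2dist N (σ²(S_ωAT_τ)) (σ²(A)) < (√(8φ² log(2/δ₁)/s) + φ√(32φ² log(2/δ₂)/c)) ‖A‖_F²`
  is `> 1 − δ₁ − δ₂ − δ₃` — i.e. `ε‖A‖_F²` with probability `≥ 1 − δ` for
  `s, c = O(φ⁴ ε⁻² log(1/δ))` (the printed `Ω̃(φ² ε⁻² log(1/δ))` up to the oversampling constants
  the `Ω̃` absorbs: `‖SA‖_F² ≤ φ‖A‖_F²` always, and `φ' ≤ 2φ`).

No named facts are introduced; everything stated is proved.

## References
* [ChiaEtAl2022] N.-H. Chia, A. Gilyén, T. Li, H.-H. Lin, E. Tang, C. Wang, J. ACM 69(5):33, 2022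
  (= arXiv:1910.06151), §3.2 Lemma "Approximating singular values", §5.2 (its proof), §2.3
  Lemma 2.14, Lemma 5.2.
* [HornJohnson2013] R. A. Horn, C. R. Johnson, *Matrix Analysis*, 2nd ed., Cor. 6.3.8 and
  Thm 1.3.22 — via `HoffmanWielandt` and `ABvsBAEigenvalues`.
-/

noncomputable section

open scoped Matrix

namespace Literature.Computability.QuantumComplexity

namespace SampleQuery

open Finset Literature.Analysis.Matrix.HoffmanWielandt Literature.Analysis.Matrix.ABvsBAEigenvalues

variable {m n s c : ℕ} {φ : ℝ} {A : Matrix (Fin m) (Fin n) ℝ}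

/-! ### Squared singular values, padded -/

/-- A real Gram matrix `MᵀM` is symmetric. `[folklore]` (private plumbing) -/
private theorem gramT_isHermitian {a b : ℕ} (M : Matrix (Fin a) (Fin b) ℝ) : (Mᵀ * M).IsHermitian := by
  simpa [Matrix.conjTranspose_eq_transpose_of_trivial] using Matrix.isHermitian_conjTranspose_mul_self M

/-- **`σ²(M)`**: the squared singular values `σ_1(M)² ≥ σ_2(M)² ≥ …` of a real `a×b` matrix — the
decreasingly sorted eigenvalues of `MᵀM` — padded by zeros to a sequence on `ℕ` ("where `σ̂_i = 0`
for `i > min(r,c)`"). [cite: ChiaEtAl2022, §3.2 Lemma "Approximating singular values"] -/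
def sqSingularValues {a b : ℕ} (M : Matrix (Fin a) (Fin b) ℝ) : ℕ → ℝ :=
  paddedEigenvalues (gramT_isHermitian M)

/-- `σ²(Mᵀ) = σ²(M)` as padded sequences: `MMᵀ` and `MᵀM` have the same non-zero spectrum
(Horn–Johnson Thm 1.3.22). [cite: ChiaEtAl2022, §3.2 Lemma "Approximating singular values"
("`σ̂_i = 0` for `i > min(r,c)`")]; [cite: HornJohnson2013, Thm 1.3.22] -/
theorem sqSingularValues_transpose {a b : ℕ} (M : Matrix (Fin a) (Fin b) ℝ) :
    sqSingularValues Mᵀ = sqSingularValues M := by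
  unfold sqSingularValues
  have h := paddedEigenvalues_conjTranspose_mul_self (𝕜 := ℝ) M
  -- over `ℝ`, `Mᴴ = Mᵀ`
  have e1 : (Mᴴ * M) = Mᵀ * M := by rw [Matrix.conjTranspose_eq_transpose_of_trivial]
  have e2 : (M * Mᴴ) = Mᵀᵀ * Mᵀ := by
    rw [Matrix.conjTranspose_eq_transpose_of_trivial, Matrix.transpose_transpose]
  have key : ∀ {P Q : Matrix (Fin b) (Fin b) ℝ} (hP : P.IsHermitian) (hQ : Q.IsHermitian), P = Q →
      paddedEigenvalues hP = paddedEigenvalues hQ := by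
    intro P Q hP hQ hPQ; subst hPQ; rfl
  have key' : ∀ {P Q : Matrix (Fin a) (Fin a) ℝ} (hP : P.IsHermitian) (hQ : Q.IsHermitian), P = Q →
      paddedEigenvalues hP = paddedEigenvalues hQ := by
    intro P Q hP hQ hPQ; subst hPQ; rfl
  rw [key' (gramT_isHermitian Mᵀ) (Matrix.isHermitian_mul_conjTranspose_self M) e2.symm,
    ← h, key (Matrix.isHermitian_conjTranspose_mul_self M) (gramT_isHermitian M) e1]

/-! ### `ℓ²` distance of padded sequences over a range -/

/-- `‖f − g‖_{ℓ²([0,N))} = √(Σ_{k<N} (f k − g k)²)`. [cite: ChiaEtAl2022, §3.2 Lemma "Approximating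
singular values" (the quantity `√Σ_i (σ̂_i² − σ_i²)²`)] -/
def l2dist (N : ℕ) (f g : ℕ → ℝ) : ℝ := Real.sqrt (∑ k ∈ range N, (f k - g k) ^ 2)

/-- `l2dist` is non-negative. [cite: ChiaEtAl2022, §3.2 Lemma "Approximating singular values"] -/
theorem l2dist_nonneg (N : ℕ) (f g : ℕ → ℝ) : 0 ≤ l2dist N f g := Real.sqrt_nonneg _

/-- **Triangle inequality** for `l2dist` ("The result follows from the triangle inequality").
[cite: ChiaEtAl2022, §5.2, proof of Lemma "Approximating singular values"] -/
theorem l2dist_triangle (N : ℕ) (f g h : ℕ → ℝ) : l2dist N f h ≤ l2dist N f g + l2dist N g h := by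
  unfold l2dist
  rw [Finset.sum_range (fun k => (f k - h k) ^ 2), Finset.sum_range (fun k => (f k - g k) ^ 2),
    Finset.sum_range (fun k => (g k - h k) ^ 2)]
  have ht := dist_triangle (WithLp.toLp 2 (fun k : Fin N => f k) : EuclideanSpace ℝ (Fin N))
    (WithLp.toLp 2 (fun k : Fin N => g k)) (WithLp.toLp 2 (fun k : Fin N => h k))
  simpa only [EuclideanSpace.dist_eq, Real.dist_eq, sq_abs, PiLp.toLp_apply] using ht

/-! ### Hoffman–Wielandt, padded -/

/-- **Hoffman–Wielandt for squared singular values (padded)**: for real `B` (`a×b`) and `A`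
(`a'×b`) with the same number of columns and every `N ≥ b`,
`√(Σ_{k<N} (σ_k(B)² − σ_k(A)²)²) ≤ ‖BᵀB − AᵀA‖_F`. [cite: ChiaEtAl2022, §5.2 Lemma 5.2
(Hoffman–Wielandt) as used in the proof of Lemma "Approximating singular values"] -/
theorem sqSingularValues_dist_le_frob {a a' b : ℕ} (B : Matrix (Fin a) (Fin b) ℝ)
    (A : Matrix (Fin a') (Fin b) ℝ) {N : ℕ} (hN : b ≤ N) :
    l2dist N (sqSingularValues B) (sqSingularValues A) ≤ Real.sqrt (frobSq (Bᵀ * B - Aᵀ * A)) := by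
  unfold l2dist sqSingularValues
  refine Real.sqrt_le_sqrt ?_
  rw [sum_range_paddedEigenvalues_sub_sq (gramT_isHermitian B) (gramT_isHermitian A)
    (by simpa using hN), frobSq_sub]
  have h := hoffman_wielandt_real (gramT_isHermitian B) (gramT_isHermitian A)
  simpa only [Matrix.sub_apply, Fintype.card_fin] using h

/-! ### The deterministic core: two sketches, triangle inequality -/

/-- **Deterministic core.** For any row sketch `S` (sample `ω`, distribution `p`) and any column
sketch `T = T'ᵀ` of `R = SA` (sample `τ`, distribution `q`, `T' = sketch q τ` acting on `Rᵀ`),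
with `C = RT` (so `Cᵀ = T'Rᵀ`) and every `N ≥ max(n, s)`:
`√Σ_{k<N}(σ_k(C)² − σ_k(A)²)² ≤ ‖(T'Rᵀ)ᵀ(T'Rᵀ) − RRᵀ‖_F + ‖RᵀR − AᵀA‖_F` — Hoffman–Wielandt
twice, `σ²(Rᵀ) = σ²(R)` (zero padding), and the triangle inequality.
[cite: ChiaEtAl2022, §5.2, proof of Lemma "Approximating singular values" (the two displayed
inequalities and "The result follows from the triangle inequality")] -/
theorem sqSingularValues_sketch_dist_le (p : Fin m → ℝ) (ω : Fin s → Fin m) (q : Fin n → ℝ)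
    (τ : Fin c → Fin n) (A : Matrix (Fin m) (Fin n) ℝ) {N : ℕ} (hNn : n ≤ N) (hNs : s ≤ N) :
    l2dist N (sqSingularValues (sketch q τ * (sketch p ω * A)ᵀ)ᵀ) (sqSingularValues A) ≤
      Real.sqrt (frobSq ((sketch q τ * (sketch p ω * A)ᵀ)ᵀ * (sketch q τ * (sketch p ω * A)ᵀ) -
          (sketch p ω * A)ᵀᵀ * (sketch p ω * A)ᵀ)) +
        Real.sqrt (frobSq ((sketch p ω * A)ᵀ * (sketch p ω * A) - Aᵀ * A)) := by
  set R := sketch p ω * A with hR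
  set C' := sketch q τ * Rᵀ with hC'
  calc l2dist N (sqSingularValues C'ᵀ) (sqSingularValues A)
      ≤ l2dist N (sqSingularValues C'ᵀ) (sqSingularValues R) +
          l2dist N (sqSingularValues R) (sqSingularValues A) := l2dist_triangle N _ _ _
    _ = l2dist N (sqSingularValues C') (sqSingularValues Rᵀ) +
          l2dist N (sqSingularValues R) (sqSingularValues A) := by
        rw [sqSingularValues_transpose C', sqSingularValues_transpose R]
    _ ≤ Real.sqrt (frobSq (C'ᵀ * C' - Rᵀᵀ * Rᵀ)) + Real.sqrt (frobSq (Rᵀ * R - Aᵀ * A)) :=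
        add_le_add (sqSingularValues_dist_le_frob C' Rᵀ hNs) (sqSingularValues_dist_le_frob R A hNn)

/-! ### The Lemma: two-stage sketching approximates the singular values -/

/-- Inclusion–exclusion step: the mass of `E ∩ G` is at least the mass of `E` minus the mass of
`Gᶜ` (non-negative weights). `[folklore]` (private plumbing) -/
private theorem sum_filter_and_ge {ι : Type*} (u : Finset ι) (w : ι → ℝ) (hw : ∀ i, 0 ≤ w i)
    (E G : ι → Prop) [DecidablePred E] [DecidablePred G] :
    ∑ i ∈ u.filter E, w i - ∑ i ∈ u.filter (fun i => ¬ G i), w i ≤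
      ∑ i ∈ u.filter (fun i => E i ∧ G i), w i := by
  classical
  have hsplit : ∑ i ∈ u.filter E, w i =
      ∑ i ∈ (u.filter E).filter G, w i + ∑ i ∈ (u.filter E).filter (fun i => ¬ G i), w i :=
    (sum_filter_add_sum_filter_not _ _ _).symm
  rw [hsplit, filter_filter]
  have hle : ∑ i ∈ (u.filter E).filter (fun i => ¬ G i), w i ≤ ∑ i ∈ u.filter (fun i => ¬ G i), w i :=
    sum_le_sum_of_subset_of_nonneg (fun i hi => by
      simp only [mem_filter] at hi ⊢; exact ⟨hi.1.1, hi.2⟩) (fun i _ _ => hw i)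
  linarith

/-- **Lemma "Approximating singular values" (CGLLTW §3.2; Frobenius form, explicit constants).**
Let `SQ_φ(A)` be given (`A ≠ 0`, witness `Ã`), `s, c ≥ 1`, `δ₁, δ₂, δ₃ > 0`, `s ≥ 2φ² ln(1/δ₃)`.
Sample `ω ∈ [m]^s` i.i.d. from `𝒟_ã` (row sketch `S_ω`, `R = S_ωA`) and then `τ ∈ [n]^c` i.i.d.
from the row-norm distribution of `(S_ωÃ)ᵀ` (the `SQ((SA)†)` sampler of Lemma 2.14; column sketch
`T_τ`, `C = RT_τ`).  Then the two-stage mass of the outcomes `(ω, τ)` with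
`√Σ_{k<N}(σ_k(C)² − σ_k(A)²)² < (√(8φ² log(2/δ₁)/s) + φ·√(32φ² log(2/δ₂)/c))·‖A‖_F²`
(any `N ≥ max(n,s)`; squared singular values padded by zeros) exceeds `1 − δ₁ − δ₂ − δ₃`.
Ingredients, as printed: the key lemma for `S` (error `√(8φ² log(2/δ₁)/s)‖A‖_F²`, mass `> 1−δ₁`);
Lemma 2.14 (`φ_ω ≤ 2φ` off an event of mass `≤ δ₃`) and the key lemma for `T†` as a
`2φ`-oversampled sketch of `(SA)ᵀ` (error `√(8(2φ)² log(2/δ₂)/c)‖SA‖_F² ≤ φ√(32φ² log(2/δ₂)/c)‖A‖_F²`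
since `‖SA‖_F² ≤ φ‖A‖_F²`, mass `> 1−δ₂` for every good `ω`); Hoffman–Wielandt twice and the
triangle inequality (`sqSingularValues_sketch_dist_le`).
[cite: ChiaEtAl2022, §3.2 Lemma "Approximating singular values" and §5.2 (its proof)] -/
theorem approximating_singular_values (W : MatrixOversamplingWitness φ A) (hA : A ≠ 0)
    (hs : 0 < s) (hc : 0 < c) {δ₁ δ₂ δ₃ : ℝ} (hδ₁ : 0 < δ₁) (hδ₂ : 0 < δ₂) (hδ₃ : 0 < δ₃)
    (hsδ : 2 * φ ^ 2 * Real.log (1 / δ₃) ≤ s) {N : ℕ} (hNn : n ≤ N) (hNs : s ≤ N) :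
    1 - δ₁ - δ₂ - δ₃ <
      ∑ ω : Fin s → Fin m, iidWeight (rowDist W.tilde) ω *
        ∑ τ ∈ univ.filter (fun τ : Fin c → Fin n =>
          l2dist N (sqSingularValues
              (sketch (rowDist (sketch (rowDist W.tilde) ω * W.tilde)ᵀ) τ *
                (sketch (rowDist W.tilde) ω * A)ᵀ)ᵀ) (sqSingularValues A) <
            (Real.sqrt (8 * φ ^ 2 * Real.log (2 / δ₁) / s) +
              φ * Real.sqrt (32 * φ ^ 2 * Real.log (2 / δ₂) / c)) * frobSq A),
          iidWeight (rowDist (sketch (rowDist W.tilde) ω * W.tilde)ᵀ) τ := by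
  classical
  -- notation
  set p : Fin m → ℝ := rowDist W.tilde with hpdef
  set θ₁ : ℝ := Real.sqrt (8 * φ ^ 2 * Real.log (2 / δ₁) / s) * frobSq A with hθ₁
  set θ₂ : ℝ := φ * Real.sqrt (32 * φ ^ 2 * Real.log (2 / δ₂) / c) * frobSq A with hθ₂
  have hthr : (Real.sqrt (8 * φ ^ 2 * Real.log (2 / δ₁) / s) +
      φ * Real.sqrt (32 * φ ^ 2 * Real.log (2 / δ₂) / c)) * frobSq A = θ₁ + θ₂ := by
    rw [hθ₁, hθ₂]; ring
  simp_rw [hthr]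
  have hp := W.isOversampledDist_rowDist hA
  have hφ := W.pos hA
  have hF : 0 < frobSq A := frobSq_pos hA
  have hw0 : ∀ ω : Fin s → Fin m, 0 ≤ iidWeight p ω := iidWeight_nonneg hp.nonneg
  -- stage 1 events: `E₁` = key lemma for `S`, `G` = Lemma 2.14's good event
  let E₁ : (Fin s → Fin m) → Prop := fun ω =>
    Real.sqrt (frobSq ((sketch p ω * A)ᵀ * (sketch p ω * A) - Aᵀ * A)) < θ₁
  let G : (Fin s → Fin m) → Prop := fun ω => frobSq A / 2 ≤ frobSq (sketch p ω * A)
  have hE₁ : 1 - δ₁ < ∑ ω ∈ univ.filter E₁, iidWeight p ω := by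
    have hkey := approx_matrix_product' hp hp hφ hφ hA hA hs hδ₁
    have havg : (fun k => (p k + p k) / 2) = p := funext fun k => by ring
    rw [havg] at hkey
    have hthr' : Real.sqrt (8 * φ * φ * Real.log (2 / δ₁) / s) *
        (Real.sqrt (frobSq A) * Real.sqrt (frobSq A)) = θ₁ := by
      rw [hθ₁, Real.mul_self_sqrt (frobSq_nonneg A), show (8 : ℝ) * φ * φ = 8 * φ ^ 2 by ring]
    rw [hthr'] at hkey
    exact hkey
  have hG : ∑ ω ∈ univ.filter (fun ω => ¬ G ω), iidWeight p ω ≤ δ₃ := by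
    have h := iid_mass_frobSq_sketch_lt_half_le W hA hs hδ₃ hsδ
    refine le_of_eq_of_le (sum_congr ?_ fun _ _ => rfl) h
    ext ω; simp only [mem_filter, mem_univ, true_and, G, not_le, hpdef]
  have hEG : 1 - δ₁ - δ₃ < ∑ ω ∈ univ.filter (fun ω => E₁ ω ∧ G ω), iidWeight p ω := by
    have := sum_filter_and_ge univ (iidWeight p) hw0 E₁ G
    linarith
  -- stage 2: for every good `ω`, the `τ`-mass of the good outcomes exceeds `1 − δ₂`
  have hstage2 : ∀ ω, E₁ ω ∧ G ω →
      1 - δ₂ < ∑ τ ∈ univ.filter (fun τ : Fin c → Fin n =>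
          l2dist N (sqSingularValues (sketch (rowDist (sketch p ω * W.tilde)ᵀ) τ *
            (sketch p ω * A)ᵀ)ᵀ) (sqSingularValues A) < θ₁ + θ₂),
        iidWeight (rowDist (sketch p ω * W.tilde)ᵀ) τ := by
    rintro ω ⟨hωE, hωG⟩
    set R := sketch p ω * A with hRdef
    have hRpos : 0 < frobSq R := lt_of_lt_of_le (by linarith) hωG
    have hRne : R ≠ 0 := fun h0 => by
      rw [h0] at hRpos; simp [frobSq_eq_sum_sq] at hRpos
    have hRtne : Rᵀ ≠ 0 := fun h0 => hRne (by simpa using congrArg Matrix.transpose h0)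
    -- the witness `SQ_{φ_ω}((S_ωA)ᵀ)` of Lemma 2.14, with `φ_ω ≤ 2φ`
    let W₂ := (W.sketched ω hRne).transpose
    have hφω : sketchPhi W ω ≤ 2 * φ := sketchPhi_le_two_mul W hA ω hωG
    have hq : IsOversampledDist (2 * φ) (rowNorms Rᵀ) (rowDist (sketch p ω * W.tilde)ᵀ) := by
      have h := W₂.isOversampledDist_rowDist hRtne
      simp only [W₂, MatrixOversamplingWitness.transpose_tilde,
        MatrixOversamplingWitness.sketched_tilde] at h
      exact h.mono (W₂.pos hRtne) hφω
    have h2φ : 0 < 2 * φ := by linarith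
    have hkey := approx_matrix_product' hq hq h2φ h2φ hRtne hRtne hc hδ₂
    have havg : (fun k => (rowDist (sketch p ω * W.tilde)ᵀ k + rowDist (sketch p ω * W.tilde)ᵀ k) / 2) =
        rowDist (sketch p ω * W.tilde)ᵀ := funext fun k => by ring
    rw [havg] at hkey
    -- the stage-2 threshold is at most `θ₂` since `‖Rᵀ‖_F² = ‖SA‖_F² ≤ φ‖A‖_F²`
    have hRle : frobSq Rᵀ ≤ φ * frobSq A := by
      rw [frobSq_transpose]; exact frobSq_sketch_mul_le hp hφ ω
    have hthr2 : Real.sqrt (8 * (2 * φ) * (2 * φ) * Real.log (2 / δ₂) / c) *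
        (Real.sqrt (frobSq Rᵀ) * Real.sqrt (frobSq Rᵀ)) ≤ θ₂ := by
      rw [Real.mul_self_sqrt (frobSq_nonneg _), hθ₂,
        show (8 : ℝ) * (2 * φ) * (2 * φ) = 32 * φ ^ 2 by ring]
      calc Real.sqrt (32 * φ ^ 2 * Real.log (2 / δ₂) / c) * frobSq Rᵀ
          ≤ Real.sqrt (32 * φ ^ 2 * Real.log (2 / δ₂) / c) * (φ * frobSq A) :=
            mul_le_mul_of_nonneg_left hRle (Real.sqrt_nonneg _)
        _ = φ * Real.sqrt (32 * φ ^ 2 * Real.log (2 / δ₂) / c) * frobSq A := by ring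
    refine lt_of_lt_of_le hkey (sum_le_sum_of_subset_of_nonneg ?_ fun τ _ _ =>
      iidWeight_nonneg hq.nonneg τ)
    intro τ hτ
    simp only [mem_filter, mem_univ, true_and] at hτ ⊢
    -- deterministic core + the two Frobenius events
    have hcore := sqSingularValues_sketch_dist_le p ω (rowDist (sketch p ω * W.tilde)ᵀ) τ A hNn hNs
    have h2 : Real.sqrt (frobSq ((sketch (rowDist (sketch p ω * W.tilde)ᵀ) τ * Rᵀ)ᵀ *
        (sketch (rowDist (sketch p ω * W.tilde)ᵀ) τ * Rᵀ) - Rᵀᵀ * Rᵀ)) < θ₂ :=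
      lt_of_lt_of_le hτ hthr2
    calc _ ≤ _ := hcore
      _ < θ₂ + θ₁ := add_lt_add h2 hωE
      _ = θ₁ + θ₂ := add_comm _ _
  -- assemble: total mass ≥ Σ_{ω ∈ E₁ ∩ G} w(ω) (1 − δ₂) ≥ (1 − δ₁ − δ₃)(1 − δ₂) ≥ 1 − δ₁ − δ₂ − δ₃
  have hinner_nonneg : ∀ ω : Fin s → Fin m, 0 ≤ ∑ τ ∈ univ.filter (fun τ : Fin c → Fin n =>
      l2dist N (sqSingularValues (sketch (rowDist (sketch p ω * W.tilde)ᵀ) τ *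
        (sketch p ω * A)ᵀ)ᵀ) (sqSingularValues A) < θ₁ + θ₂),
      iidWeight (rowDist (sketch p ω * W.tilde)ᵀ) τ := fun ω =>
    sum_nonneg fun τ _ => iidWeight_nonneg (fun k => div_nonneg (normSq_nonneg _) (frobSq_nonneg _)) τ
  rcases le_or_gt 1 δ₂ with hδ₂1 | hδ₂1
  · -- trivial regime `δ₂ ≥ 1`: the bound is below `0 ≤` total mass … unless `δ₁ + δ₃ < 0`, impossible
    calc 1 - δ₁ - δ₂ - δ₃ < 0 := by linarith
      _ ≤ _ := sum_nonneg fun ω _ => mul_nonneg (hw0 ω) (hinner_nonneg ω)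
  calc 1 - δ₁ - δ₂ - δ₃ ≤ (1 - δ₁ - δ₃) * (1 - δ₂) := by
        have : 0 ≤ δ₂ * (δ₁ + δ₃) := by positivity
        nlinarith
    _ < (∑ ω ∈ univ.filter (fun ω => E₁ ω ∧ G ω), iidWeight p ω) * (1 - δ₂) :=
        mul_lt_mul_of_pos_right hEG (by linarith)
    _ = ∑ ω ∈ univ.filter (fun ω => E₁ ω ∧ G ω), iidWeight p ω * (1 - δ₂) := by rw [sum_mul]
    _ ≤ ∑ ω ∈ univ.filter (fun ω => E₁ ω ∧ G ω), iidWeight p ω *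
          ∑ τ ∈ univ.filter (fun τ : Fin c → Fin n =>
            l2dist N (sqSingularValues (sketch (rowDist (sketch p ω * W.tilde)ᵀ) τ *
              (sketch p ω * A)ᵀ)ᵀ) (sqSingularValues A) < θ₁ + θ₂),
            iidWeight (rowDist (sketch p ω * W.tilde)ᵀ) τ :=
        sum_le_sum fun ω hω => mul_le_mul_of_nonneg_left
          (hstage2 ω (by simpa only [mem_filter, mem_univ, true_and] using hω)).le (hw0 ω)
    _ ≤ _ := sum_le_sum_of_subset_of_nonneg (filter_subset _ _) fun ω _ _ =>
          mul_nonneg (hw0 ω) (hinner_nonneg ω)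

end SampleQuery

end Literature.Computability.QuantumComplexity

end
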